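/-
Copyright (c) 2026. All rights reserved.
Released under Apache 2.0 license as described in the file LICENSE.
-/
import Literature.NumberTheory.PAdicHodge.DeRhamFilteredComparison
import Literature.NumberTheory.GaloisRepresentations.LabelledWeightsDual
import Literature.NumberTheory.GaloisRepresentations.LabelledWeightsCoeffBaseChange
import Literature.NumberTheory.GaloisRepresentations.LabelledWeightsDeRhamRank
import Literature.NumberTheory.GaloisRepresentations.PstWeilDeligneTwistDeRham
import Literature.NumberTheory.GaloisRepresentations.PstWeilDeligneDualDeRham
import HarnessLib

/-!
# `HT_τ(ρ^∨) = −HT_τ(ρ)` for de Rham `ρ : Γ_K → GL_n(ℚ̄_ℓ)` and Fontaine's pinned `B_dR(K)`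

Topic `NumberTheory/PAdicHodge`; theorems only (no definition, no named fact, no `sorry`).  The accepted
abstract `PeriodRingData.labelledHodgeTateWeights_dual` (labelled Hodge–Tate weights of the
contragredient of an admissible framed representation over a period ring that is a field, given the
filtered comparison) is specialised to Fontaine's `B_dR(K)` of a non-archimedean local field `K ⊇ ℚ_ℓ`
and `ℚ̄_ℓ`-coefficients:

* `labelledHodgeTateWeights_dual_of_eq_bdR` — for any `ℚ_ℓ`-structure on `K` with `K/ℚ_ℓ` finite,
  `𝔅 = bdRPeriodRingData hK` and a de Rham framed `ρ : Γ_K → GL_n(ℚ̄_ℓ)`: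
  **`HT_τ(ρ^∨) = {−h : h ∈ HT_τ(ρ)}`** for every label `τ : K → ℚ̄_ℓ` (`ρ^∨ = FramedRep.dual ρ`).  Read
  on a finite admissible model `rE'` over `E' ⊇ τ(K)` (accepted
  `IsDeRhamWith.exists_hasQlModel_labelledHodgeTateWeights_eq`) and its contragredient `rE'^∨`, a model
  of `ρ^∨` (accepted `HasQlModel.dual`) admissible by the accepted `FramedRep.IsDeRhamWith.dual` and
  model independence (`IsDeRhamWith.isAdmissible_of_hasQlModel`); Wach's filtered comparison for
  `B_dR` is the accepted `exists_basis_mem_filTensor_iff_of_isDeRham`.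
* `fontainePst_labelledHodgeTateWeights_dual` — the same for THE pinned datum `fontainePst K ℓ hK`
  (accepted `fontainePst_𝔅_eq_bdRPeriodRingData`, `fontainePst_finiteDimensional`).
* `FramedGaloisRep.labelledHodgeTateWeightsAt_dual_of_isDeRhamFramed`,
  `FramedGaloisRep.labelledHodgeTateWeightsAt_dual_nodup_iff` — for a number field `K`,
  `ρ : Γ_K →ₜ* GL_n(ℚ̄_ℓ)`, a place `v ∣ ℓ` at which `ρ|_{Γ_{K_v}}` is de Rham for THE pinned datum
  `fontainePstAdicCompletion v ℓ hv` of the summit statements, and a continuous label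
  `τ : K_v → ℚ̄_ℓ`: **`HT_τ(ρ^∨|_{Γ_{K_v}}) = −HT_τ(ρ|_{Γ_{K_v}})`**, and the labelled weights of `ρ^∨`
  at `v` are multiplicity-free iff those of `ρ` are (`FramedGaloisRep.labelledHodgeTateWeightsAt`).

## References
* [FontaineAsterisque223III] J.-M. Fontaine, *Représentations p-adiques semi-stables*, Astérisque 223
  (1994), Exp. III §1.5, Prop. 1.5.2.
* [BrinonConrad2009] O. Brinon, B. Conrad, *CMI Summer School notes on p-adic Hodge theory* (2009),
  §6.3 (`D_dR` commutes with duals as a filtered functor).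
* [Patrikis2019] S. Patrikis, *Variations on a theorem of Tate*, Mem. AMS 258 (2019), §2.3.1, §2.7.1.
-/

noncomputable section

open scoped TensorProduct NumberField
open TensorProduct Field IsDedekindDomain ValuativeRel
open Literature.NumberTheory.GaloisRepresentations Literature.NumberTheory.Automorphic

namespace Literature.NumberTheory.PAdicHodge

-- Mathlib's own global value of `maxSynthPendingDepth` (see `LabelledWeightsTwist`); the tensor
-- types need a higher instance-synthesis budget.
set_option maxSynthPendingDepth 3
set_option synthInstance.maxHeartbeats 200000

section Local

variable {K : Type} [Field K] [ValuativeRel K] [TopologicalSpace K] [IsNonarchimedeanLocalField K]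
  [CharZero K] {ℓ : ℕ} [Fact ℓ.Prime]

/-- **`HT_τ(ρ^∨) = −HT_τ(ρ)` for Fontaine's `B_dR(K)`** (any `ℚ_ℓ`-structure on `K` with `K/ℚ_ℓ`
finite; `𝔅 = bdRPeriodRingData hK`, stated through an equation so as to apply to THE pinned datum) and
a de Rham framed `ρ : Γ_K → GL_n(ℚ̄_ℓ)` with contragredient `ρ^∨ = FramedRep.dual ρ`: read on a
finite admissible model `rE'` over `E' ⊇ τ(K)` and its contragredient, where it is the abstract
`PeriodRingData.labelledHodgeTateWeights_dual` fed with Wach's filtered comparison for `B_dR`.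
[cite: FontaineAsterisque223III, Exp. III §1.5, Prop. 1.5.2] [cite: BrinonConrad2009, §6.3] [cite: Patrikis2019, §2.3.1 and §2.7.1] -/
theorem labelledHodgeTateWeights_dual_of_eq_bdR (hK : valuation K ℓ < 1) [Algebra ℚ_[ℓ] K]
    [FiniteDimensional ℚ_[ℓ] K] [Fact (¬ IsUnit ((ℓ : ℕ) : integerC K))]
    [IsAdicComplete (Ideal.span {((ℓ : ℕ) : integerC K)}) (integerC K)]
    (𝔅 : PeriodRingData.{0, 0, 0, 0} (absoluteGaloisGroup K) ℚ_[ℓ] K)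
    (h𝔅 : 𝔅 = bdRPeriodRingData (F := K) (p := ℓ) hK) {n : ℕ}
    {ρ : FramedRep (absoluteGaloisGroup K) (PadicAlgCl ℓ) n}
    (hρ : ρ.IsDeRhamWith ‹Algebra ℚ_[ℓ] K› 𝔅) (τ : K →ₐ[ℚ_[ℓ]] PadicAlgCl ℓ) :
    𝔅.labelledHodgeTateWeights (FramedRep.toContinuousRep (FramedRep.dual ρ)) τ.toRingHom =
      (𝔅.labelledHodgeTateWeights (FramedRep.toContinuousRep ρ) τ.toRingHom).map fun w => -w := by
  classical
  have hB : IsField 𝔅.B := by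
    haveI := isDomain_bDeRhamPlus (F := K) (p := ℓ) (surjective_fontaineTheta_integerC hK)
    rw [h𝔅]
    exact Field.toIsField (FracBdR K ℓ)
  -- a finite admissible model `rE'` of `ρ` computing the weights at `τ`
  obtain ⟨E', hfinE', rE', hmodel, hsplit, -, hadm, hall⟩ :=
    FramedRep.IsDeRhamWith.exists_hasQlModel_labelledHodgeTateWeights_eq 𝔅 hB hρ
  haveI := hfinE'
  haveI : ContinuousSMul ℚ_[ℓ] E' := IntermediateField.continuousSMul_padicAlgCl E'
  obtain ⟨τ₀, hτ, hfinτ₀, -, -, hHT⟩ := hall τ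
  haveI := hfinτ₀
  -- its contragredient is an admissible model of `ρ^∨`
  have hmodel' : HasQlModel (FramedRep.dual ρ) E' (FramedRep.dual rE') := hmodel.dual
  have hadm' : 𝔅.IsAdmissible ((FramedRep.toContinuousRep rE'.dual).restrictScalars ℚ_[ℓ]) :=
    (hρ.dual ‹Algebra ℚ_[ℓ] K› 𝔅).isAdmissible_of_hasQlModel ‹Algebra ℚ_[ℓ] K› 𝔅 hmodel'
  -- Wach's filtered comparison for the model and its contragredient
  have hcomp : ∃ (d : ℕ) (𝒷 : Module.Basis (Fin d) 𝔅.B (𝔅.B ⊗[ℚ_[ℓ]] (Fin n → E')))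
      (w : Fin d → ℤ),
      (∀ k, 𝒷 k ∈ 𝔅.D ((FramedRep.toContinuousRep rE').restrictScalars ℚ_[ℓ])) ∧
      (∀ k, 𝒷 k ∈ 𝔅.filTensor (Fin n → E') (w k)) ∧
      ∀ (j : ℤ) (x : 𝔅.B ⊗[ℚ_[ℓ]] (Fin n → E')),
        x ∈ 𝔅.filTensor (Fin n → E') j ↔ ∀ k, 𝒷.repr x k ∈ 𝔅.fil (j - w k) := by
    subst h𝔅
    exact exists_basis_mem_filTensor_iff_of_isDeRham hK _ hadm
  have hcomp' : ∃ (d : ℕ) (𝒷 : Module.Basis (Fin d) 𝔅.B (𝔅.B ⊗[ℚ_[ℓ]] (Fin n → E')))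
      (w : Fin d → ℤ),
      (∀ k, 𝒷 k ∈ 𝔅.D ((FramedRep.toContinuousRep rE'.dual).restrictScalars ℚ_[ℓ])) ∧
      (∀ k, 𝒷 k ∈ 𝔅.filTensor (Fin n → E') (w k)) ∧
      ∀ (j : ℤ) (x : 𝔅.B ⊗[ℚ_[ℓ]] (Fin n → E')),
        x ∈ 𝔅.filTensor (Fin n → E') j ↔ ∀ k, 𝒷.repr x k ∈ 𝔅.fil (j - w k) := by
    subst h𝔅
    exact exists_basis_mem_filTensor_iff_of_isDeRham hK _ hadm'
  -- the abstract theorem on the models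
  have hdual :=
    PeriodRingData.labelledHodgeTateWeights_dual 𝔅 hB hsplit rE' hadm hadm' hcomp hcomp' τ₀
  -- `D_{τ₀}(rE'^∨)` is finite-dimensional (Fontaine's count)
  haveI : FiniteDimensional E'
      (𝔅.labelD (FramedRep.toContinuousRep (FramedRep.dual rE')) τ₀.toRingHom) :=
    (𝔅.finrank_labelD_eq_of_isAdmissible hB hsplit rE'.dual hadm' τ₀).1
  rw [hHT, FramedRep.labelledHodgeTateWeights_eq_of_hasQlModel 𝔅 hmodel' hsplit τ τ₀ hτ, hdual]

/-- **`HT_τ(ρ^∨) = −HT_τ(ρ)` for THE pinned datum** `fontainePst K ℓ hK` (period ring `B_dR(K)`,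
accepted `fontainePst_𝔅_eq_bdRPeriodRingData`; `K/ℚ_ℓ` finite, accepted `fontainePst_finiteDimensional`),
a de Rham `ρ : Γ_K → GL_n(ℚ̄_ℓ)` and every label `τ : K → ℚ̄_ℓ`.
[cite: FontaineAsterisque223III, Exp. III §1.5, Prop. 1.5.2] [cite: BrinonConrad2009, §6.3]
[cite: Patrikis2019, §2.7.1] -/
theorem fontainePst_labelledHodgeTateWeights_dual (hK : valuation K ℓ < 1) {n : ℕ}
    {ρ : FramedRep (absoluteGaloisGroup K) (PadicAlgCl ℓ) n}
    (hρ : (fontainePst K ℓ hK).IsDeRhamFramed ρ) :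
    letI := (fontainePst K ℓ hK).algebra
    ∀ τ : K →ₐ[ℚ_[ℓ]] PadicAlgCl ℓ,
      (fontainePst K ℓ hK).𝔅.labelledHodgeTateWeights
          (FramedRep.toContinuousRep (FramedRep.dual ρ)) τ.toRingHom =
        ((fontainePst K ℓ hK).𝔅.labelledHodgeTateWeights (FramedRep.toContinuousRep ρ)
          τ.toRingHom).map fun w => -w := by
  letI := (fontainePst K ℓ hK).algebra
  intro τ
  haveI : Fact (¬ IsUnit ((ℓ : ℕ) : integerC K)) := ⟨not_isUnit_natCast_integerC hK⟩
  haveI : IsAdicComplete (Ideal.span {((ℓ : ℕ) : integerC K)}) (integerC K) :=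
    isAdicComplete_integerC_natCast hK
  haveI : FiniteDimensional ℚ_[ℓ] K := fontainePst_finiteDimensional hK
  exact labelledHodgeTateWeights_dual_of_eq_bdR hK _ (fontainePst_𝔅_eq_bdRPeriodRingData hK) hρ τ

/-- **The dual of a de Rham `ρ` has the same number of labelled weights, all negated** — in particular
`card HT_τ(ρ^∨) = card HT_τ(ρ)` for THE pinned datum. [cite: Patrikis2019, §2.7.1] -/
theorem fontainePst_card_labelledHodgeTateWeights_dual (hK : valuation K ℓ < 1) {n : ℕ}
    {ρ : FramedRep (absoluteGaloisGroup K) (PadicAlgCl ℓ) n}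
    (hρ : (fontainePst K ℓ hK).IsDeRhamFramed ρ) :
    letI := (fontainePst K ℓ hK).algebra
    ∀ τ : K →ₐ[ℚ_[ℓ]] PadicAlgCl ℓ,
      Multiset.card ((fontainePst K ℓ hK).𝔅.labelledHodgeTateWeights
          (FramedRep.toContinuousRep (FramedRep.dual ρ)) τ.toRingHom) =
        Multiset.card ((fontainePst K ℓ hK).𝔅.labelledHodgeTateWeights
          (FramedRep.toContinuousRep ρ) τ.toRingHom) := by
  intro τ
  rw [fontainePst_labelledHodgeTateWeights_dual hK hρ τ, Multiset.card_map]

end Local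

/-! ### The summit's datum at `v ∣ ℓ`: `HT_τ(ρ^∨|_{Γ_{K_v}}) = −HT_τ(ρ|_{Γ_{K_v}})` -/

section NumberField

variable {K : Type} [Field K] [NumberField K] {ℓ : ℕ} [Fact ℓ.Prime] {n : ℕ}

/-- **Labelled Hodge–Tate weights of the contragredient at a de Rham place `v ∣ ℓ`.**  For
`ρ : Γ_K →ₜ* GL_n(ℚ̄_ℓ)` (`K` a number field), a place `v ∣ ℓ` at which `ρ|_{Γ_{K_v}}` is de Rham for
THE pinned datum `fontainePstAdicCompletion v ℓ hv` of the summit statements, and every CONTINUOUS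
label `τ : K_v →+* ℚ̄_ℓ` (automatically `ℚ_ℓ`-linear, accepted
`adicCompletion_ringHom_commutes_of_continuous`):
`HT_τ(ρ^∨|_{Γ_{K_v}}) = {−h : h ∈ HT_τ(ρ|_{Γ_{K_v}})}` (`FramedGaloisRep.labelledHodgeTateWeightsAt`;
`ρ^∨|_{Γ_{K_v}} = (ρ|_{Γ_{K_v}})^∨`, accepted `FramedGaloisRep.dual_toLocal`).
[cite: FontaineAsterisque223III, Exp. III §1.5, Prop. 1.5.2] [cite: Patrikis2019, §2.7.1] -/
theorem _root_.Literature.NumberTheory.GaloisRepresentations.FramedGaloisRep.labelledHodgeTateWeightsAt_dual_of_isDeRhamFramed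
    (ρ : FramedGaloisRep K (PadicAlgCl ℓ) n) (v : HeightOneSpectrum (𝓞 K))
    (hv : ((ℓ : ℕ) : 𝓞 K) ∈ v.asIdeal)
    (hρ : (fontainePstAdicCompletion v ℓ hv).IsDeRhamFramed (ρ.toLocal v))
    (τ : v.adicCompletion K →+* PadicAlgCl ℓ) (hτ : Continuous τ) :
    FramedGaloisRep.labelledHodgeTateWeightsAt (FramedRep.dual ρ) v
        (fontainePstAdicCompletion v ℓ hv).algebra (fontainePstAdicCompletion v ℓ hv).𝔅 τ =
      (ρ.labelledHodgeTateWeightsAt v (fontainePstAdicCompletion v ℓ hv).algebra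
        (fontainePstAdicCompletion v ℓ hv).𝔅 τ).map fun w => -w := by
  haveI := LocalField.charZero_adicCompletion v
  letI := (fontainePstAdicCompletion v ℓ hv).algebra
  let τ' : v.adicCompletion K →ₐ[ℚ_[ℓ]] PadicAlgCl ℓ :=
    ⟨τ, adicCompletion_ringHom_commutes_of_continuous v hv τ hτ⟩
  have h := fontainePst_labelledHodgeTateWeights_dual
    (LocalField.valuation_adicCompletion_natCast_lt_one v ℓ hv) hρ τ'
  rw [FramedGaloisRep.labelledHodgeTateWeightsAt_def, FramedGaloisRep.labelledHodgeTateWeightsAt_def]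
  exact h

/-- **The labelled weights of `ρ^∨` at a de Rham place `v ∣ ℓ` are multiplicity-free iff those of `ρ`
are** (negation is injective) — the regularity clause of the Fontaine–Mazur / reciprocity statements
of the tree is self-dual. [cite: Patrikis2019, §2.7.1] -/
theorem _root_.Literature.NumberTheory.GaloisRepresentations.FramedGaloisRep.labelledHodgeTateWeightsAt_dual_nodup_iff
    (ρ : FramedGaloisRep K (PadicAlgCl ℓ) n) (v : HeightOneSpectrum (𝓞 K))
    (hv : ((ℓ : ℕ) : 𝓞 K) ∈ v.asIdeal)
    (hρ : (fontainePstAdicCompletion v ℓ hv).IsDeRhamFramed (ρ.toLocal v))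
    (τ : v.adicCompletion K →+* PadicAlgCl ℓ) (hτ : Continuous τ) :
    (FramedGaloisRep.labelledHodgeTateWeightsAt (FramedRep.dual ρ) v
        (fontainePstAdicCompletion v ℓ hv).algebra (fontainePstAdicCompletion v ℓ hv).𝔅 τ).Nodup ↔
      (ρ.labelledHodgeTateWeightsAt v (fontainePstAdicCompletion v ℓ hv).algebra
        (fontainePstAdicCompletion v ℓ hv).𝔅 τ).Nodup := by
  rw [ρ.labelledHodgeTateWeightsAt_dual_of_isDeRhamFramed v hv hρ τ hτ]
  exact Multiset.nodup_map_iff_of_injective neg_injective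

/-- **`card HT_τ(ρ^∨|_{Γ_{K_v}}) = card HT_τ(ρ|_{Γ_{K_v}})`** at a de Rham place `v ∣ ℓ`, for a continuous
label `τ`. [cite: Patrikis2019, §2.7.1] -/
theorem _root_.Literature.NumberTheory.GaloisRepresentations.FramedGaloisRep.card_labelledHodgeTateWeightsAt_dual
    (ρ : FramedGaloisRep K (PadicAlgCl ℓ) n) (v : HeightOneSpectrum (𝓞 K))
    (hv : ((ℓ : ℕ) : 𝓞 K) ∈ v.asIdeal)
    (hρ : (fontainePstAdicCompletion v ℓ hv).IsDeRhamFramed (ρ.toLocal v))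
    (τ : v.adicCompletion K →+* PadicAlgCl ℓ) (hτ : Continuous τ) :
    Multiset.card (FramedGaloisRep.labelledHodgeTateWeightsAt (FramedRep.dual ρ) v
        (fontainePstAdicCompletion v ℓ hv).algebra (fontainePstAdicCompletion v ℓ hv).𝔅 τ) =
      Multiset.card (ρ.labelledHodgeTateWeightsAt v (fontainePstAdicCompletion v ℓ hv).algebra
        (fontainePstAdicCompletion v ℓ hv).𝔅 τ) := by
  rw [ρ.labelledHodgeTateWeightsAt_dual_of_isDeRhamFramed v hv hρ τ hτ, Multiset.card_map]

end NumberField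

end Literature.NumberTheory.PAdicHodge

end
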